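import Summits.QuantumFields.BalabanUV.Beta.FP.TowerFWeightGaugeDropout

/-!
# `BalabanUV.Beta.FP.TowerFWeightDualGaugeOfColumn` — row D1 ∕ (C1) OWNER «beta-an2», PART 100, ROUTE T (β1), option (3a), FINDING AN2-85-1 (B) closed on the row's side: **THE END's
# DUAL GAUGE LETTER `hgaugeD j` AT THE TRUE WEIGHT FOLLOWS BY NAME FROM ONE COLUMN LETTER (K1ᶜ) AND THE SCALAR `α j ≠ 0`** — road g63 `FP/TowerFRowsTrueWeightDual` displays, per storey,
# `hgaugeD j : ∀ a ψ M, (∀ c x, |ψ c x| ≤ M) → codiff₁ ψ = 0 → lip1 ψ (fun c x => (α j)⁻¹ * wF … j c a (−x) − wStep Lc (j+1) c a (−x)) = 0`; by PART 96 `wF_apply` the weight read at `−x` is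
# `wFRec … j a 0 c x`, by PART 98∕99 `lip1_wFRec_rooted_eq_colH ∕ _sym_eq_colH` its pairing with a bounded co-closed `ψ` is `((Lc⁴)⁻¹)^(j+1) · ⟨ψ, contourSum (Lc^(j+1)) (colH (chartσ …) (Lc^(j+2)) a 0)⟩`,
# so `hgaugeD j` ⟸ **(K1ᶜ)_j : `⟨ψ, contourSum (Lc^(j+1)) (colH (chartσ Lc (sn j) j) (Lc^(j+2)) a 0)⟩ = (α j · (Lc⁴)^(j+1)) · ⟨ψ, fun c x => wStep Lc (j+1) c a (−x)⟩`** for bounded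
# co-closed `ψ` — the column letter of K1.md §6's family (by value T3 ∕ A2-HQF0 (G); NOT claimed here) — and `α j ≠ 0` (journal [AN2-G85-W-11], [AN2-G85-LANDED-56], [AN2-G85-W-13])
# (β-function cell `pub-balaban`, BINDER-OWNERS row D1)

WHAT ([folklore]; 0 `def`): §1 `lip1_sub_smul` (linearity of the pairing under summability), `summable_pair_wFRec` (PART 97 `exists_abs_wFRec_le`), `summable_pair_wStep_neg` (g58 `abs_wStep_le`);
§2 **`hgaugeD_of_columnLetter`** (generic brick: PART 99's conclusion shape `hpair` as hypothesis), **`hgaugeD_rooted_of_columnLetter`**, **`hgaugeD_sym_of_columnLetter`** — the road's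
`hgaugeD j` TEXT at `w := (α j)⁻¹ • wF` from (K1ᶜ)_j + `α j ≠ 0`, at both row tokens.
WHAT THIS IS NOT: not (K1ᶜ) (displayed); nothing of the END instantiated; nothing of Bałaban's asserted, valued or discharged; 0 estimates; 0∕4 row-D1 binders; NOT (C1), NOT D1,
NEVER «G-an2-4 closed», NOT BetaPertH, NOT continuum, NOT Clay.

HONEST DEPENDENCY (page 1, mandatory): continuum YM on T⁴ ⇐ BetaPertH ∧ nine spine estimates (0/9 proved); BetaPertH ⇐ (D1) ∧ (D4) ∧ CAP+tail;
G-an2-4 gates asym, D1 and NE2/3/4.  HONEST FRAMING (cell contract, verbatim): «discharging `BetaPertH` makes Bałaban's UV stability UNCONDITIONAL —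
a real constructive-QFT result; it is NOT the continuum limit and NOT the Clay problem.»  ABSOLUTE RULE (cell charter, verbatim): «No internally-minted
statement may enter as a cited fact. Every hypothesis is either kernel-proved in this package or a verbatim quotation of a PUBLISHED theorem with page
reference. The manuscript(s) under audit are NOT citable for their own disputed steps — they are the thing under adjudication; programme-internal
(2001/route/tribunal) claims are never citable.»  Row D1 ∕ (C1) OWNER «beta-an2», b2b-balaban-beta-an2 gen 85, 2026-08-30.  No existing file touched.
-/

noncomputable section

open Finset
open scoped BigOperators
open Literature.MathematicalPhysics.QuantumFieldTheory
open Literature.MathematicalPhysics.QuantumFieldTheory.Balaban1983to89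
open Literature.MathematicalPhysics.QuantumFieldTheory.Balaban1983to89.Beta
open B12Sec2to5 (l1 l1_nonneg)
open AffineAveraging (Form0 Form1 Site box toSite unitVec dz codiff₁ contourSum)
open AveragingContoursRooted (ctrOff ctrOff_mem_box)
open AveragingHessianKernels (Bond ell)
open AveragingHessianKernelsRooted (linKerAt)
open OneStepKernelFamily (colH)
open KKTFluctuationEnergy (lip1)
open DressedMomentNormalisation (EKer)
open HessianTelescopingKKT (wStep)
open Summit.QuantumFields.BalabanUV.Beta.AxialDressingRooted (one_le_of_neZero)
open Summit.QuantumFields.BalabanUV.Beta.SymAveragingHessianCounts (symLinKerAt)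
open Summit.QuantumFields.BalabanUV.Beta.CompositeOneShotJetData (Roots Roots.ctr AN)
open Summit.QuantumFields.BalabanUV.Beta.FP.TorusCompositeObjectsG (StepRows)
open Summit.QuantumFields.BalabanUV.Beta.FP.TowerFTransportRow (abs_wStep_le)
open Summit.QuantumFields.BalabanUV.Beta.FP.TowerFWeightRecDefs
open Summit.QuantumFields.BalabanUV.Beta.FP.TowerFWeightRecLoc (exists_abs_wFRec_le l1_neg')
open Summit.QuantumFields.BalabanUV.Beta.FP.TowerFWeightGaugeDropout (lip1_wFRec_rooted_eq_colH lip1_wFRec_sym_eq_colH)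

namespace Summit.QuantumFields.BalabanUV.Beta.FP.TowerFWeightDualGaugeOfColumn

/-! ## §1 Linearity of the pairing and the two summabilities -/

section Lin

/-- [folklore] `⟨ψ, r•A − B⟩ = r·⟨ψ, A⟩ − ⟨ψ, B⟩` when both pairings converge absolutely enough (`Summable` of the row sums). -/
theorem lip1_sub_smul (ψ A B : Form1 (3 + 1) ℝ) (r : ℝ)
    (hA : Summable fun x : Site (3 + 1) => ∑ c : Fin (3 + 1), ψ c x * A c x) (hB : Summable fun x : Site (3 + 1) => ∑ c : Fin (3 + 1), ψ c x * B c x) :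
    lip1 ψ (fun c x => r * A c x - B c x) = r * lip1 ψ A - lip1 ψ B := by
  unfold lip1
  have h : ∀ x, ∑ c : Fin (3 + 1), ψ c x * (r * A c x - B c x)
      = r * (∑ c : Fin (3 + 1), ψ c x * A c x) - ∑ c : Fin (3 + 1), ψ c x * B c x := by
    intro x
    rw [Finset.mul_sum, ← Finset.sum_sub_distrib]
    exact Finset.sum_congr rfl fun c _ => by ring
  simp_rw [h]
  rw [(hA.mul_left r).tsum_sub hB, tsum_mul_left]

variable (Lc : ℕ) [NeZero Lc] (Q : StepRows 3 Lc) {ℓ : Fin (3 + 1) → Site (3 + 1) → Bond (3 + 1) → ℝ} (sn : ℕ → ℝ)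

/-- [folklore] the pairing of a bounded covector with the true weight's column `t ↦ wFRec … n a 0 c t` converges (PART 97 `exists_abs_wFRec_le` + lit `summable_exp_shift'`). -/
theorem summable_pair_wFRec {Bℓ : ℝ} (hB : 0 ≤ Bℓ) (hℓb : ∀ (μ : Fin (3 + 1)) (y : Site (3 + 1)) (f : Bond (3 + 1)), |ℓ μ y f| ≤ Bℓ)
    {ψ : Form1 (3 + 1) ℝ} {M : ℝ} (hψ : ∀ c x, |ψ c x| ≤ M) (n : ℕ) (a : Fin (3 + 1)) :
    Summable fun x : Site (3 + 1) => ∑ c : Fin (3 + 1), ψ c x * wFRec Lc Q ℓ sn n a 0 c x := by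
  obtain ⟨δ, C, hδ, hC, h⟩ := exists_abs_wFRec_le Lc Q sn hB hℓb n
  have hM : 0 ≤ M := (abs_nonneg _).trans (hψ 0 0)
  refine summable_sum fun c _ => ?_
  refine (((ExpKernelCalculus.summable_exp_shift' hδ (0 : Site (3 + 1))).mul_left (M * C))).of_norm_bounded fun x => ?_
  rw [Real.norm_eq_abs, abs_mul]
  have h1 := h a 0 c x
  rw [smul_zero] at h1
  calc |ψ c x| * |wFRec Lc Q ℓ sn n a 0 c x| ≤ M * (C * Real.exp (-δ * l1 (x - 0))) := mul_le_mul (hψ c x) h1 (abs_nonneg _) hM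
    _ = M * C * Real.exp (-δ * l1 (x - 0)) := by ring

omit [NeZero Lc] in
/-- [folklore] the pairing of a bounded covector with the canonical step column read at `−x` converges (g58 `abs_wStep_le`). -/
theorem summable_pair_wStep_neg [NeZero Lc] {ψ : Form1 (3 + 1) ℝ} {M : ℝ} (hψ : ∀ c x, |ψ c x| ≤ M) (j : ℕ) (a : Fin (3 + 1)) :
    Summable fun x : Site (3 + 1) => ∑ c : Fin (3 + 1), ψ c x * wStep Lc j c a (-x) := by
  obtain ⟨δ, C, hδ, hC, h⟩ := abs_wStep_le Lc j
  have hM : 0 ≤ M := (abs_nonneg _).trans (hψ 0 0)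
  refine summable_sum fun c _ => ?_
  refine (((ExpKernelCalculus.summable_exp_shift' hδ (0 : Site (3 + 1))).mul_left (M * C))).of_norm_bounded fun x => ?_
  rw [Real.norm_eq_abs, abs_mul]
  have h1 := h c a (-x)
  rw [l1_neg'] at h1
  calc |ψ c x| * |wStep Lc j c a (-x)| ≤ M * (C * Real.exp (-δ * l1 x)) := mul_le_mul (hψ c x) h1 (abs_nonneg _) hM
    _ = M * C * Real.exp (-δ * l1 (x - 0)) := by rw [sub_zero]; ring

end Lin

/-! ## §2 The dual gauge letter from the column letter -/

section Gauge

variable (Lc : ℕ) [NeZero Lc] (Q : StepRows 3 Lc) {ℓ : Fin (3 + 1) → Site (3 + 1) → Bond (3 + 1) → ℝ} (sn α : ℕ → ℝ)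

/-- [folklore] **`hgaugeD_of_columnLetter` — GENERIC BRICK.**  If the true weight's pairing with bounded co-closed covectors is `cW ·` the pairing of the straight contour sum of the
σ-chart's column (PART 99's conclusion shape, `hpair`), and that column pairs like `(α n · cW⁻¹) ·` the canonical step column read at `−x` ((K1ᶜ), `hK1c`), then the road's dual gauge
letter holds at `w := (α n)⁻¹ • wF`: `lip1 ψ (fun c x => (α n)⁻¹ * wF … n c a (−x) − wStep Lc (n+1) c a (−x)) = 0`. -/
theorem hgaugeD_of_columnLetter {Bℓ : ℝ} (hB : 0 ≤ Bℓ) (hℓb : ∀ (μ : Fin (3 + 1)) (y : Site (3 + 1)) (f : Bond (3 + 1)), |ℓ μ y f| ≤ Bℓ)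
    (n : ℕ) (hα : α n ≠ 0) {cW : ℝ} (hcW : cW ≠ 0) (a : Fin (3 + 1)) (ψ : Form1 (3 + 1) ℝ) (M : ℝ) (hψ : ∀ c x, |ψ c x| ≤ M)
    (hpair : lip1 ψ (fun c t => wFRec Lc Q ℓ sn n a 0 c t)
      = cW * lip1 ψ (contourSum (Lc ^ (n + 1)) (fun κ' u => colH (chartσ Lc (sn n) n) (Lc ^ (n + 1 + 1)) a 0 κ' u)))
    (hK1c : lip1 ψ (contourSum (Lc ^ (n + 1)) (fun κ' u => colH (chartσ Lc (sn n) n) (Lc ^ (n + 1 + 1)) a 0 κ' u))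
      = (α n * cW⁻¹) * lip1 ψ (fun c x => wStep Lc (n + 1) c a (-x))) :
    lip1 ψ (fun c x => (α n)⁻¹ * wF Lc Q ℓ sn n c a (-x) - wStep Lc (n + 1) c a (-x)) = 0 := by
  have hw : ∀ (c : Fin (3 + 1)) (x : Site (3 + 1)), wF Lc Q ℓ sn n c a (-x) = wFRec Lc Q ℓ sn n a 0 c x := by
    intro c x; rw [wF_apply, neg_neg]
  simp_rw [hw]
  rw [lip1_sub_smul ψ (fun c t => wFRec Lc Q ℓ sn n a 0 c t) (fun c x => wStep Lc (n + 1) c a (-x)) ((α n)⁻¹)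
      (summable_pair_wFRec Lc Q sn hB hℓb hψ n a) (summable_pair_wStep_neg Lc hψ (n + 1) a),
    hpair, hK1c]
  field_simp
  ring

variable (R : Roots Lc)

/-- [folklore] **`hgaugeD_rooted_of_columnLetter` — THE ROAD's `hgaugeD n` AT THE ROOTED ROWS FROM (K1ᶜ)_n AND `α n ≠ 0`** (PART 99 `lip1_wFRec_rooted_eq_colH`, `cW = ((Lc⁴)⁻¹)^(n+1)`). -/
theorem hgaugeD_rooted_of_columnLetter (n : ℕ) (hα : α n ≠ 0)
    (hK1c : ∀ (a : Fin (3 + 1)) (ψ : Form1 (3 + 1) ℝ) (M : ℝ), (∀ c x, |ψ c x| ≤ M) → codiff₁ ψ = 0 →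
      lip1 ψ (contourSum (Lc ^ (n + 1)) (fun κ' u => colH (chartσ Lc (sn n) n) (Lc ^ (n + 1 + 1)) a 0 κ' u))
        = (α n * (((((Lc : ℝ) ^ (3 + 1))⁻¹) ^ (n + 1))⁻¹)) * lip1 ψ (fun c x => wStep Lc (n + 1) c a (-x)))
    (a : Fin (3 + 1)) (ψ : Form1 (3 + 1) ℝ) (M : ℝ) (hψ : ∀ c x, |ψ c x| ≤ M) (hco : codiff₁ ψ = 0) :
    lip1 ψ (fun c x => (α n)⁻¹ * wF Lc Q (linKerAt (toSite (ctrOff (3 + 1) Lc)) Lc) sn n c a (-x) - wStep Lc (n + 1) c a (-x)) = 0 := by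
  have hL : (Lc : ℝ) ≠ 0 := by exact_mod_cast (NeZero.ne Lc)
  have hcW : ((((Lc : ℝ) ^ (3 + 1))⁻¹) ^ (n + 1)) ≠ 0 := pow_ne_zero _ (inv_ne_zero (pow_ne_zero _ hL))
  exact hgaugeD_of_columnLetter Lc Q sn α (Bℓ := (ell (3 + 1) Lc : ℝ)) (by positivity)
    (fun μ' y' f => AveragingHessianKernelsRooted.abs_linKerAt_le (one_le_of_neZero Lc) μ' y' (ctrOff_mem_box (one_le_of_neZero Lc)) f)
    n hα hcW a ψ M hψ (lip1_wFRec_rooted_eq_colH Lc Q sn hψ hco n a 0) (hK1c a ψ M hψ hco)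

/-- [folklore] **`hgaugeD_sym_of_columnLetter`** — the same at the SYM rows of a root record `R` (PART 99 `lip1_wFRec_sym_eq_colH`). -/
theorem hgaugeD_sym_of_columnLetter (n : ℕ) (hα : α n ≠ 0)
    (hK1c : ∀ (a : Fin (3 + 1)) (ψ : Form1 (3 + 1) ℝ) (M : ℝ), (∀ c x, |ψ c x| ≤ M) → codiff₁ ψ = 0 →
      lip1 ψ (contourSum (Lc ^ (n + 1)) (fun κ' u => colH (chartσ Lc (sn n) n) (Lc ^ (n + 1 + 1)) a 0 κ' u))
        = (α n * (((((Lc : ℝ) ^ (3 + 1))⁻¹) ^ (n + 1))⁻¹)) * lip1 ψ (fun c x => wStep Lc (n + 1) c a (-x)))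
    (a : Fin (3 + 1)) (ψ : Form1 (3 + 1) ℝ) (M : ℝ) (hψ : ∀ c x, |ψ c x| ≤ M) (hco : codiff₁ ψ = 0) :
    lip1 ψ (fun c x => (α n)⁻¹ * wF Lc Q (symLinKerAt (toSite R.r) Lc) sn n c a (-x) - wStep Lc (n + 1) c a (-x)) = 0 := by
  have hL : (Lc : ℝ) ≠ 0 := by exact_mod_cast (NeZero.ne Lc)
  have hcW : ((((Lc : ℝ) ^ (3 + 1))⁻¹) ^ (n + 1)) ≠ 0 := pow_ne_zero _ (inv_ne_zero (pow_ne_zero _ hL))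
  exact hgaugeD_of_columnLetter Lc Q sn α (Bℓ := (ell (3 + 1) Lc : ℝ)) (by positivity)
    (fun μ' y' f => SymAveragingHessianCounts.abs_symLinKerAt_le (one_le_of_neZero Lc) μ' y' R.hr f)
    n hα hcW a ψ M hψ (lip1_wFRec_sym_eq_colH Lc Q sn R hψ hco n a 0) (hK1c a ψ M hψ hco)

end Gauge

end Summit.QuantumFields.BalabanUV.Beta.FP.TowerFWeightDualGaugeOfColumn

end
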